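import Summits.BirchSwinnertonDyer.BirchSwinnertonDyer.Theorems.ByReductionTypeAtTwoTowerLayerRank
import Summits.BirchSwinnertonDyer.Rank1Residual.X5.TwoAdicTargetsMultDoorsTwinA
import Summits.BirchSwinnertonDyer.Rank1Residual.X5.TwoAdicTargetsEndStateClosed
import HarnessLib

/-!
# Route `ByReductionTypeAtTwo`, child `MultLowerHalfAtTwo` (item stmt-BirchSwinnertonDyer-19923): the MEMO
# binder `hlow : X5.O1.SelmerLambdaLowerBoundAtTwo W n` of the Kato-INT pinch doors is DISCHARGED from
# PRINT (Greenberg 1999, Prop. 4.14 at `p = 2`) + ONE finite-layer count `2^n ≤ #Sel_{2^∞}(E/ℚ_j)[2]`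

HONEST FRAMING (cell `bsd-2adic`, run/shared/lean/pub/bsd-2adic/, seat `bsd-2adic-mult-3` GEN 6, HUMAN
RULINGS D-0036 / D-0054 / D-0074 row (A)): research route; THEOREMS ONLY — no definition, no new named fact,
nothing asserted, nothing booked; BSD is not proved by any of this. PARTITION (D-0054): X5@2 mult, `E[2]`
irreducible (K4ᵐ, RESIDUAL-MAP B1·O1; of the 1 976 book230 classes: the 808 non-split ∧ surjective ∧ `Δ < 0`
classes of CENSUS-6, first the 66 TIER-1 classes whose ACCEPTED `BSD₂` files `X5/TwoAdicInstancesINT*.lean` /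
`…Twin*.lean` display `(hlow : SelmerLambdaLowerBoundAtTwo c 2)`) × p = 2 — types-the-object-of (item 19923
per class: the `λ`-LOWER input of the pinch); closes none by itself.

## What the binder `hlow` is, and why it is not research-grade

Every Kato-INT pinch door at a multiplicative `2` (`X5.O1.bsdp_two_nonsplit_of_katoIntPinch` p419632 and its
GUARDED twin `…'` p428361; `…split_of_katoIntPinch` p433154; `…split_of_katoUpToOnePinch_of_mu` p443104; the
rank-`0` `2`-converse twins) displays, next to Kato's divisibility WITH the `2`-power part (T-KATO2-NS/SPMULT,
MEMO) and the certificates `λ_an = n` / `μ_an = 0`, the hypothesis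
`hlow : X5.O1.SelmerLambdaLowerBoundAtTwo W n` — «for every cyclotomic dual datum `D` with `X` torsion and
`μ(X) = 0`, `n ≤ λ(X)`» — carried as a MEMO binder (HOME/mult/PROOF-KATO2MULT.md §6.2, Lemmas P/Q on
Greenberg's Prop. 4.14). It is the EISENSTEIN-direction input of the pinch: Kato gives `λ(X) ≤ λ_an`, and
`hlow` with `n = λ_an` squeezes `char_Λ X = (L₂)`, hence BOTH halves of `BSD₂` — in particular the instance
of THIS seat's item `MultLowerHalfAtTwo` (19923) at the class.

Since the tower lanes landed (for the good-ordinary block, but REDUCTION-TYPE-FREE):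
* `KatoHalfPinch.le_lambdaInvariant_of_pow_le_natCard_quotient_towerIdeal` (ord-2, `…TowerLambdaRank`): a
  finitely generated torsion `Λ`-module `M` with `μ(M) = 0` and no nonzero finite submodule has
  `#(M/(p,T^j)M) ≤ p^{λ(M)}`, so `p^n ≤ #(M/(p,T^j)M) ⇒ n ≤ λ(M)` (pure algebra);
* `KatoHalfPinch.towerRank_of_layerSelmerTwoTorsion` (tower-1, `…TowerLayerRank`): for `W/ℚ` with ODD torsion
  order, `2^n ≤ #Sel_{2^∞}(E/ℚ_j)[2]` for every cyclotomic `κ` gives `2^n ≤ #X/(2,T^{2^j})X` for every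
  cyclotomic dual datum (Greenberg's injective map `s_j`, `E(ℚ_∞)[2] = 0`);
* the PUBLISHED Greenberg 1999 Prop. 4.14 READ AT `2` (`Greenberg1999.prop414_noFiniteSubmodule_of_not_dvd_torsionOrder`,
  Literature named fact; audit lane D-AUDIT h414 PASS-filed 2026-08-26): `2 ∤ #E(ℚ)_tors` and `X` torsion ⇒
  `X` has no nonzero finite `Λ`-submodule — printed proof in the good-ordinary-OR-MULTIPLICATIVE setting,
and since `SelmerLambdaLowerBoundAtTwo` CARRIES `X` torsion ∧ `μ(X) = 0` as hypotheses (so NO tower-gap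
certificate is needed, unlike the `μ`-side doors), the binder is a THEOREM modulo PRINT + one certificate:

* §1 `selmerLambdaLowerBoundAtTwo_of_layerSelmer`: `h414` + `2 ∤ #E(ℚ)_tors` + (for every cyclotomic `κ`)
  `2^n ≤ #Sel_{2^∞}(E/ℚ_j)[2]` at ONE layer `j` ⟹ `SelmerLambdaLowerBoundAtTwo W n` (any reduction type,
  any `j`); `…_of_selmerTwoTorsion`: the layer-`0` count spelled `κ`-FREE on `Sel_{2^∞}(E/ℚ)` of file
  `Selmer` (`2^n ≤ #Sel_{2^∞}(E/ℚ)[2]`; `Sel_{2^∞}(E/ℚ_0) ≃+ Sel_{2^∞}(E/ℚ)`,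
  `nonempty_selmerLayer_zero_addEquiv`); `…_of_twoAdicSurjective`: the torsion side condition discharged on
  the doors' own locus (`ρ_{E,2^∞}` surjective ⇒ `E[2]` irreducible ⇒ `2 ∤ #E(ℚ)_tors`).
* §2 the NON-SPLIT Kato-INT doors RE-GLUED with `hlow` discharged (GUARDED twin `h41` =
  `…thm41Analogue_charValue_rankZero_numberField_anyPrime_oddLocalDegree`, audit h41 V2):
  `bsdp_two_nonsplit_of_katoInt_of_layerSelmer` / `…_of_selmerTwoTorsion` (`BSDp W 2`) and the rank-`0`
  `2`-converse `analyticRank_eq_zero_of_finite_selmer_of_katoInt_of_layerSelmer` (S3ᵐ lane).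
* §3 `missingLowerBoundAt_two_nonsplit_of_katoInt_of_layerSelmer`: the instance of item 19923
  (`Typed.MissingLowerBoundAt W 2`) at such a curve.
The SPLIT doors are re-glued in the companion file `…MultLowerHalfSelmerRankSplit.lean`.

WHAT IS DISPLAYED, NOT PROVED (numbers, not adjectives). PRINT: Greenberg Prop. 4.14@2 (`h414`), the guarded
Thm-4.1 analogue (`h41`), modularity (`hmod`), GZK (`hGZK`). MEMO: T-KATO2-NSMULT (`hKint`, PROOF-KATO2MULT
Thm. A, referee pending) — UNCHANGED, the one memo binder left on these rows. CERTIFICATES per class: `λ_an = n`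
(`hlan`), `μ_an = 0` (`hμan`) (two-engine on 1 969/1 976 classes, eng-2 TABLE-MULT-E2.v3), `0 ≤ ord₂ ϖ`
(`hper₀`), and the NEW certificate slot `2^n ≤ #Sel_{2^∞}(E/ℚ_j)[2]`: at `j = 0` with `n = 2` it is the
two-engine `dim_{𝔽₂} Sel₂(E/ℚ) = 2`, `E(ℚ)[2] = 0` of CENSUS-6 / CERT-SEL2-AB-X5ALL (all 66 + 97 tier-1
classes); at `j = 1` (`ℚ(√2)`) it is a `2`-descent over `ℚ(√2)` (tier 2, `λ_an = 3`: e.g. the K = 4 singletons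
172042o1, 219558q1 of item 19923's per-class residue — NOT run by any engine today). ∀-LEVEL CONTENT for
19923: none — the ∀-statement (Eisenstein direction of the `2`-adic main conjecture at a multiplicative `2`)
remains open mathematics (seat verdict GEN 0–6); this file removes a MEMO binder from its per-class road.

References: R. Greenberg, LNM 1716 (1999), §1 p. 60, §3 pp. 85–86, Prop. 4.14 (p. 124), §4 pp. 112–113;
L. Washington, *Introduction to Cyclotomic Fields*, §13.2; K. Kato, Astérisque 295 (2004), 17.11–17.13;
B. Mazur, J. Tate, J. Teitelbaum, Invent. Math. 84 (1986), §I.14; R. L. Miller, LMS J. Comput. Math. 14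
(2011), Def. 1.1; J.-P. Serre, Invent. Math. 15 (1972), §4; B. Mazur, IHÉS 47 (1977), III §5.
-/

set_option autoImplicit false
set_option linter.dupNamespace false

noncomputable section

open scoped Classical MatrixGroups ModularForm

open CongruenceSubgroup WeierstrassCurve Literature.NumberTheory.EllipticCurves
  Literature.NumberTheory.EllipticCurves.ModularForms
  Literature.NumberTheory.EllipticCurves.Greenberg1999
  Literature.NumberTheory.EllipticCurves.Rank1Residual
  Literature.NumberTheory.EllipticCurves.Rank1Residual.Typed Summit.BirchSwinnertonDyer.Rank1Residual
  Summit.BirchSwinnertonDyer.Rank1Residual.X5 Summit.BirchSwinnertonDyer.Rank1Residual.X5.O1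
  Summit.BirchSwinnertonDyer.Rank1Residual.X5.TowerGap
  Summit.BirchSwinnertonDyer.BirchSwinnertonDyer.Theorems.KatoHalfPinch

namespace Summit.BirchSwinnertonDyer.BirchSwinnertonDyer.Theorems.MultSelmerRank

variable (W : WeierstrassCurve ℚ) [W.IsElliptic] [W.IsGloballyMinimal]

/-! ## §0 The torsion side condition on the doors' locus -/

omit [W.IsGloballyMinimal] in
/-- `ρ_{E,2^∞}` surjective ⇒ `E[2]` irreducible (`irr_two_of_twoAdicSurjective`) ⇒ no rational `2`-torsion
⇒ `2 ∤ #E(ℚ)_tors` (`padicValNat_torsionOrder_eq_zero_of_irreducible`). Bookkeeping for §2.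
[cite: Serre1972, §4 (surjective ⇒ irreducible)] [cite: SilvermanAEC2009, III.2.3 (b)] -/
theorem not_two_dvd_torsionOrder_of_twoAdicSurjective (him : TwoAdicSurjective W) :
    ¬ 2 ∣ W.torsionOrder := by
  intro hdvd
  have h0 := padicValNat_torsionOrder_eq_zero_of_irreducible W 2 (irr_two_of_twoAdicSurjective W him)
  rw [padicValNat.eq_zero_iff] at h0
  rcases h0 with h | h | h
  · exact absurd h (by norm_num)
  · exact W.torsionOrder_pos_holds.ne' h
  · exact h hdvd

/-! ## §1 The discharge: PRINT Prop. 4.14@2 + one layer count ⟹ `SelmerLambdaLowerBoundAtTwo W n` -/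

/-- **`hlow` DISCHARGED (any reduction type, any layer).** For `W/ℚ` with ODD torsion order (`htors`), the
PUBLISHED Greenberg 1999 Prop. 4.14 at `2` (`h414`: `X` torsion ⇒ no nonzero finite `Λ`-submodule) and the
finite-layer certificate `hsel`: for every cyclotomic `ℤ₂`-extension `κ`, at least `2^n` two-torsion classes
in `Sel_{2^∞}(E/ℚ_j)` (`ℚ_1 = ℚ(√2)`, `ℚ_2 = ℚ(ζ₁₆)⁺`, …). Then `X5.O1.SelmerLambdaLowerBoundAtTwo W n`: for
every cyclotomic dual datum with `X` torsion and `μ(X) = 0`, `n ≤ λ(X)`. Proof: `2^n ≤ #Sel_{2^∞}(E/ℚ_j)[2] ≤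
#X/(2,T^{2^j})X` (`towerRank_of_layerSelmerTwoTorsion`: Greenberg's `s_j` is injective as `E(ℚ_∞)[2] = 0`)
`≤ #X/2X = 2^{λ(X)}` (`le_lambdaInvariant_of_pow_le_natCard_quotient_towerIdeal`: `X ≅ ℤ₂^{λ}` by `μ = 0` and
Prop. 4.14). No tower gap, no Kato, no reduction hypothesis. [cite: GreenbergLNM1716, Prop. 4.14 (p. 124), §1 p. 60 and §3 pp. 85–86]
[cite: Washington1997, §13.2] -/
theorem selmerLambdaLowerBoundAtTwo_of_layerSelmer
    (h414 : prop414_noFiniteSubmodule_of_not_dvd_torsionOrder) (htors : ¬ 2 ∣ W.torsionOrder)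
    {j n : ℕ} (hsel : ∀ κ : ZpExtension ℚ 2, κ.IsCyclotomic →
      2 ^ n ≤ Nat.card {z : W.selmerLayer κ j // 2 • z = 0}) :
    SelmerLambdaLowerBoundAtTwo W n := by
  intro κ γ hκ hγ hγ' D hX hμ
  haveI : Module.Finite (IwasawaAlgebra 2) D.X := D.module_finite_holds hγ
  obtain ⟨j', hj'⟩ := towerRank_of_layerSelmerTwoTorsion W htors hsel κ γ hκ hγ hγ' D
  exact le_lambdaInvariant_of_pow_le_natCard_quotient_towerIdeal 2 hX hμ
    (fun N hN => h414 W 2 htors κ γ hκ hγ D hX N hN) hj'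

/-- **`hlow` DISCHARGED from the layer-`0` count, `κ`-free.** As `selmerLambdaLowerBoundAtTwo_of_layerSelmer`
at `j = 0`, with the certificate spelled on the `2^∞`-Selmer group of `E/ℚ` of file `Selmer`:
`2^n ≤ #Sel_{2^∞}(E/ℚ)[2]` (`hsel`; for `E(ℚ)[2] = 0` this is `n ≤ dim_{𝔽₂} Sel₂(E/ℚ)` — the output of a
`2`-descent over `ℚ`, `n = 2` on every tier-1 class of record). The layer-`0` Selmer group of any `κ` is
`Sel_{2^∞}(E/ℚ)` (`nonempty_selmerLayer_zero_addEquiv`, Greenberg §1 p. 60 `F_0 = F`), and an additive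
equivalence preserves the `2`-torsion count. [cite: GreenbergLNM1716, Prop. 4.14 (p. 124) and §1 p. 60]
[cite: Washington1997, §13.2] -/
theorem selmerLambdaLowerBoundAtTwo_of_selmerTwoTorsion
    (h414 : prop414_noFiniteSubmodule_of_not_dvd_torsionOrder) (htors : ¬ 2 ∣ W.torsionOrder)
    {n : ℕ} (hsel : 2 ^ n ≤ Nat.card {z : W.selmerGroupPInfty 2 // 2 • z = 0}) :
    SelmerLambdaLowerBoundAtTwo W n := by
  refine selmerLambdaLowerBoundAtTwo_of_layerSelmer W h414 htors (j := 0) fun κ _ => ?_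
  obtain ⟨e⟩ := W.nonempty_selmerLayer_zero_addEquiv (p := 2) κ
  have hcard : Nat.card {z : W.selmerLayer κ 0 // 2 • z = 0} =
      Nat.card {z : W.selmerGroupPInfty 2 // 2 • z = 0} := by
    refine Nat.card_congr (e.toEquiv.subtypeEquiv fun z => ?_)
    have h2 : e (2 • z) = 2 • e z := by
      rw [two_nsmul, two_nsmul]
      exact e.map_add z z
    change 2 • z = 0 ↔ 2 • e z = 0
    rw [← h2, e.map_eq_zero_iff]
  rw [hcard]
  exact hsel

/-- **`hlow` DISCHARGED on the doors' locus** (`ρ_{E,2^∞}` surjective, so the torsion side condition of Prop. 4.14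
is automatic, §0): `h414` + the layer-`j` count ⟹ `SelmerLambdaLowerBoundAtTwo W n`.
[cite: GreenbergLNM1716, Prop. 4.14 (p. 124)] [cite: Serre1972, §4] -/
theorem selmerLambdaLowerBoundAtTwo_of_layerSelmer_of_twoAdicSurjective
    (h414 : prop414_noFiniteSubmodule_of_not_dvd_torsionOrder) (him : TwoAdicSurjective W)
    {j n : ℕ} (hsel : ∀ κ : ZpExtension ℚ 2, κ.IsCyclotomic →
      2 ^ n ≤ Nat.card {z : W.selmerLayer κ j // 2 • z = 0}) :
    SelmerLambdaLowerBoundAtTwo W n :=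
  selmerLambdaLowerBoundAtTwo_of_layerSelmer W h414 (not_two_dvd_torsionOrder_of_twoAdicSurjective W him)
    hsel

/-! ## §2 The NON-SPLIT Kato-INT pinch doors with `hlow` discharged (guarded twin `h41`) -/

/-- **DOOR (34-INT-pinch) with `hlow` DISCHARGED — `BSDp W 2`, both halves, at a NON-SPLIT `2` with `ρ_{E,2^∞}`
surjective and `Δ < 0`.** Binders: PRINT {guarded Thm-4.1 analogue `h41`, modularity `hmod`, GZK `hGZK`,
Greenberg Prop. 4.14@2 `h414`}; MEMO {T-KATO2-NSMULT `hKint`} ONLY; CERTIFICATES {`λ_an(E) = n` (`hlan`),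
`μ_an(E) = 0` (`hμan`), `0 ≤ ord₂ ϖ` (`hper₀`), the layer count `2^n ≤ #Sel_{2^∞}(E/ℚ_j)[2]` (`hsel`)}; the
curve's decidable data {`Mult W 2`, non-split, `TwoAdicSurjective W`, `Δ < 0`}; analytic rank `0`. One
application of the twin door `X5.O1.bsdp_two_nonsplit_of_katoIntPinch'` (p428361) to §1.
[cite: GreenbergLNM1716, §4 pp. 112–113 and Prop. 4.14 (p. 124)] [cite: MazurTateTeitelbaum1986Invent, §I.14]
[cite: Miller2011LMS, Def. 1.1 and §1] -/
theorem bsdp_two_nonsplit_of_katoInt_of_layerSelmer {j n : ℕ}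
    (h41 : thm41Analogue_charValue_rankZero_numberField_anyPrime_oddLocalDegree)
    (hmod : nonempty_modularParametrizationData)
    (hGZK : rank_eq_analyticRank_of_analyticRank_le_one)
    (h414 : prop414_noFiniteSubmodule_of_not_dvd_torsionOrder)
    (hKint : KatoDivisibilityAtTwoNonsplitMultInt W)
    (hper₀ : ∀ [NeZero (W.conductorNorm ℤ)] (f : CuspForm (Gamma0 (W.conductorNorm ℤ)) 2),
      IsNewformOf W f → ∀ ϖ : ℚ, (ϖ : ℝ) * W.realPeriodRat = plusPeriod f → 0 ≤ padicValRat 2 ϖ)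
    (hr : W.analyticRank = 0) (hmult : Mult W 2) (hns : ¬ W.HasSplitMultiplicativeReductionAtPrime 2)
    (him : TwoAdicSurjective W) (hΔ : W.Δ < 0)
    (hlan : X2.AnalyticLambdaEq W 2 n) (hμan : X2.AnalyticMuLE W 2 0)
    (hsel : ∀ κ : ZpExtension ℚ 2, κ.IsCyclotomic →
      2 ^ n ≤ Nat.card {z : W.selmerLayer κ j // 2 • z = 0}) : BSDp W 2 :=
  bsdp_two_nonsplit_of_katoIntPinch' W h41 hmod hGZK hKint
    (selmerLambdaLowerBoundAtTwo_of_layerSelmer_of_twoAdicSurjective W h414 him hsel)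
    hper₀ hr hmult hns him hΔ hlan hμan

/-- **DOOR (34-INT-pinch) with `hlow` DISCHARGED from the layer-`0` count `2^n ≤ #Sel_{2^∞}(E/ℚ)[2]`** (the
TIER-1 habitat: `n = λ_an = 2 = dim_{𝔽₂} Sel₂(E/ℚ)`, CENSUS-6 / CERT-SEL2-AB-X5ALL two-engine): `BSDp W 2` with
MEMO {`hKint`} only. [cite: GreenbergLNM1716, §4 pp. 112–113 and Prop. 4.14 (p. 124)]
[cite: MazurTateTeitelbaum1986Invent, §I.14] [cite: Miller2011LMS, Def. 1.1 and §1] -/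
theorem bsdp_two_nonsplit_of_katoInt_of_selmerTwoTorsion {n : ℕ}
    (h41 : thm41Analogue_charValue_rankZero_numberField_anyPrime_oddLocalDegree)
    (hmod : nonempty_modularParametrizationData)
    (hGZK : rank_eq_analyticRank_of_analyticRank_le_one)
    (h414 : prop414_noFiniteSubmodule_of_not_dvd_torsionOrder)
    (hKint : KatoDivisibilityAtTwoNonsplitMultInt W)
    (hper₀ : ∀ [NeZero (W.conductorNorm ℤ)] (f : CuspForm (Gamma0 (W.conductorNorm ℤ)) 2),
      IsNewformOf W f → ∀ ϖ : ℚ, (ϖ : ℝ) * W.realPeriodRat = plusPeriod f → 0 ≤ padicValRat 2 ϖ)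
    (hr : W.analyticRank = 0) (hmult : Mult W 2) (hns : ¬ W.HasSplitMultiplicativeReductionAtPrime 2)
    (him : TwoAdicSurjective W) (hΔ : W.Δ < 0)
    (hlan : X2.AnalyticLambdaEq W 2 n) (hμan : X2.AnalyticMuLE W 2 0)
    (hsel : 2 ^ n ≤ Nat.card {z : W.selmerGroupPInfty 2 // 2 • z = 0}) : BSDp W 2 :=
  bsdp_two_nonsplit_of_katoIntPinch' W h41 hmod hGZK hKint
    (selmerLambdaLowerBoundAtTwo_of_selmerTwoTorsion W h414
      (not_two_dvd_torsionOrder_of_twoAdicSurjective W him) hsel)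
    hper₀ hr hmult hns him hΔ hlan hμan

/-- **DOOR (34-INT-pinch), CONVERSE FORM, with `hlow` DISCHARGED** (the S3ᵐ lane's rank-`0` `2`-converse at the
class): same inputs MINUS analytic rank `0` and GZK; `Sel_{2^∞}(E/ℚ)` finite ⇒ `L(E,1) ≠ 0 ∧ r_an(E) = 0`.
[cite: GreenbergLNM1716, §4 pp. 112–113 and Prop. 4.14 (p. 124)] [cite: MazurTateTeitelbaum1986Invent, §I.14] -/
theorem analyticRank_eq_zero_of_finite_selmer_of_katoInt_of_layerSelmer {j n : ℕ}
    (h41 : thm41Analogue_charValue_rankZero_numberField_anyPrime_oddLocalDegree)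
    (hmod : nonempty_modularParametrizationData)
    (h414 : prop414_noFiniteSubmodule_of_not_dvd_torsionOrder)
    (hKint : KatoDivisibilityAtTwoNonsplitMultInt W)
    (hper₀ : ∀ [NeZero (W.conductorNorm ℤ)] (f : CuspForm (Gamma0 (W.conductorNorm ℤ)) 2),
      IsNewformOf W f → ∀ ϖ : ℚ, (ϖ : ℝ) * W.realPeriodRat = plusPeriod f → 0 ≤ padicValRat 2 ϖ)
    (hmult : Mult W 2) (hns : ¬ W.HasSplitMultiplicativeReductionAtPrime 2)
    (him : TwoAdicSurjective W) (hΔ : W.Δ < 0)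
    (hlan : X2.AnalyticLambdaEq W 2 n) (hμan : X2.AnalyticMuLE W 2 0)
    (hsel : ∀ κ : ZpExtension ℚ 2, κ.IsCyclotomic →
      2 ^ n ≤ Nat.card {z : W.selmerLayer κ j // 2 • z = 0})
    (hfin : Finite (W.selmerGroupPInfty 2)) : W.entireLFunction 1 ≠ 0 ∧ W.analyticRank = 0 :=
  analyticRank_eq_zero_of_finite_selmer_of_katoIntPinch' W h41 hmod hKint
    (selmerLambdaLowerBoundAtTwo_of_layerSelmer_of_twoAdicSurjective W h414 him hsel)
    hper₀ hmult hns him hΔ hlan hμan hfin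

/-! ## §3 Item 19923 (`MultLowerHalfAtTwo`) AT such a curve -/

/-- **The instance of `MultLowerHalfAtTwo` (item 19923) at a non-split, `2`-adically surjective, `Δ < 0` curve of
analytic rank `0`: `Typed.MissingLowerBoundAt W 2` (`ord₂ #Ш_an ≤ ord₂ #Ш`)** from PRINT {`h41`, `hmod`, `hGZK`,
`h414`} + MEMO {`hKint`} + CERTIFICATES {`hlan`, `hμan`, `hper₀`, `hsel`} — through `BSDp W 2` (§2) and the
finiteness of `Ш` at analytic rank `0` (GZK). No `hlow`, no tower gap, no reference curve, no `2`-torsion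
point. [cite: Miller2011LMS, Def. 1.1 (arXiv:1010.2431 p. 3)] [cite: GreenbergLNM1716, Prop. 4.14 (p. 124)] -/
theorem missingLowerBoundAt_two_nonsplit_of_katoInt_of_layerSelmer {j n : ℕ}
    (h41 : thm41Analogue_charValue_rankZero_numberField_anyPrime_oddLocalDegree)
    (hmod : nonempty_modularParametrizationData)
    (hGZK : rank_eq_analyticRank_of_analyticRank_le_one)
    (h414 : prop414_noFiniteSubmodule_of_not_dvd_torsionOrder)
    (hKint : KatoDivisibilityAtTwoNonsplitMultInt W)
    (hper₀ : ∀ [NeZero (W.conductorNorm ℤ)] (f : CuspForm (Gamma0 (W.conductorNorm ℤ)) 2),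
      IsNewformOf W f → ∀ ϖ : ℚ, (ϖ : ℝ) * W.realPeriodRat = plusPeriod f → 0 ≤ padicValRat 2 ϖ)
    (hr : W.analyticRank = 0) (hmult : Mult W 2) (hns : ¬ W.HasSplitMultiplicativeReductionAtPrime 2)
    (him : TwoAdicSurjective W) (hΔ : W.Δ < 0)
    (hlan : X2.AnalyticLambdaEq W 2 n) (hμan : X2.AnalyticMuLE W 2 0)
    (hsel : ∀ κ : ZpExtension ℚ 2, κ.IsCyclotomic →
      2 ^ n ≤ Nat.card {z : W.selmerLayer κ j // 2 • z = 0}) : MissingLowerBoundAt W 2 := by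
  haveI : Finite W.sha := (hGZK W (by rw [hr]; exact zero_le_one)).2
  exact (lower_and_upper_of_missingPPartAt W 2 (missingPPartAt_of_bsdp W 2
    (bsdp_two_nonsplit_of_katoInt_of_layerSelmer W h41 hmod hGZK h414 hKint hper₀ hr hmult hns him hΔ hlan
      hμan hsel))).1

end Summit.BirchSwinnertonDyer.BirchSwinnertonDyer.Theorems.MultSelmerRank

end
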